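import Literature.Computability.Complexity.CodeFPArith
import HarnessLib

/-!
# A small arithmetic expression language evaluated in polynomial time on codes

Literature / complexity toolkit (serves the clause generator of the skeleton reduction behind
Williams' Fact 3.1, `SkeletonAssembly.lean` and its sequel). The clause function of the tableau
is a large but FIXED arithmetic program in the parameters of the verifier and of the query
(mixed-radix addresses, range tests, truth-table constants, a few table look-ups). Rather than
proving each arithmetic step polynomial-time by hand, we introduce a syntax of expressions
`NE` over an environment — numbers `nums : List ℕ` (read by position), two tables of numbers
(read by two indices), and a unary cap for the exponent of `2 ^ ·` — with the evaluator
`NE.eval`, and prove ONCE, by structural induction, that every expression is evaluated on codes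
by a polynomial-time string function (`NE.codeFP_eval`, from the combinators of `CodeFP.lean`:
binary `+ - * / %`, comparison, branching, indexing, and `2 ^ min(·, cap)` through the unary
cap, `CodeFP.natPow`). `NE.codeFP_snoc` appends a computed value to the environment.

## References

* S. Arora, B. Barak, *Computational Complexity: A Modern Approach*, CUP 2009, §1.3 (robustness
  of polynomial time: composition and bounded loops) [AroraBarak2009].
-/

namespace Literature.Computability.Complexity

open _root_.Computability CodeFP

namespace SkelExpr

/-- The environment of an expression: a unary cap, the numbers, and two tables.
[folklore] -/
abbrev Env : Type := ℕ × List ℕ × List (List ℕ) × List (List ℕ)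

/-- The code of an environment. [folklore] -/
def envE : Env → List Bool := pairE unE (pairE (rawE natE) (pairE (rawE (rawE natE)) (rawE (rawE natE))))

/-- **Arithmetic expressions**: constants, positions of `nums`, `+`, `∸`, `*`, `/`, `%`,
`2 ^ min(·, cap)`, the comparisons `<` and `=` (value `1`/`0`), branching on `≠ 0`, and the
two-index look-ups in the two tables. [folklore] -/
inductive NE : Type
  | cst (c : ℕ) : NE
  | var (i : ℕ) : NE
  | add (a b : NE) : NE
  | sub (a b : NE) : NE
  | mul (a b : NE) : NE
  | div (a b : NE) : NE
  | mod (a b : NE) : NE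
  | pow2 (a : NE) : NE
  | lt (a b : NE) : NE
  | eq (a b : NE) : NE
  | cond (c t e : NE) : NE
  | tab1 (q c : NE) : NE
  | tab2 (n z : NE) : NE

namespace NE

/-- **The evaluator.** [folklore] -/
def eval : NE → Env → ℕ
  | cst c, _ => c
  | var i, x => x.2.1.getD i 0
  | add a b, x => eval a x + eval b x
  | sub a b, x => eval a x - eval b x
  | mul a b, x => eval a x * eval b x
  | div a b, x => eval a x / eval b x
  | mod a b, x => eval a x % eval b x
  | pow2 a, x => 2 ^ min (eval a x) x.1
  | lt a b, x => if eval a x < eval b x then 1 else 0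
  | eq a b, x => if eval a x = eval b x then 1 else 0
  | cond c t e, x => if eval c x = 0 then eval e x else eval t x
  | tab1 q c, x => (x.2.2.1.getD (eval q x) []).getD (eval c x) 0
  | tab2 n z, x => (x.2.2.2.getD (eval n x) []).getD (eval z x) 0

/-- The cap. [folklore] -/
theorem codeFP_cap : CodeFP envE unE (fun x : Env => x.1) := fst _ _
/-- The numbers. [folklore] -/
theorem codeFP_nums : CodeFP envE (rawE natE) (fun x : Env => x.2.1) := (snd _ _).fst'
/-- The first table. [folklore] -/
theorem codeFP_tab1 : CodeFP envE (rawE (rawE natE)) (fun x : Env => x.2.2.1) := (snd _ _).snd'.fst'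
/-- The second table. [folklore] -/
theorem codeFP_tab2 : CodeFP envE (rawE (rawE natE)) (fun x : Env => x.2.2.2) := (snd _ _).snd'.snd'

/-- `(a, b) ↦ [a < b]` as `1`/`0`. [folklore] -/
theorem codeFP_lt01 : CodeFP (pairE natE natE) natE (fun p => if p.1 < p.2 then 1 else 0) :=
  (natLt.ite (const _ 1) (const _ 0)).congr fun p => by by_cases h : p.1 < p.2 <;> simp [h]

/-- `(a, b) ↦ [a = b]` as `1`/`0`. [folklore] -/
theorem codeFP_eq01 : CodeFP (pairE natE natE) natE (fun p => if p.1 = p.2 then 1 else 0) :=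
  (natEq.ite (const _ 1) (const _ 0)).congr fun p => by by_cases h : p.1 = p.2 <;> simp [h]

/-- Two-index look-up in a table of numbers. [folklore] -/
theorem codeFP_get2 : CodeFP (pairE (rawE (rawE natE)) (pairE natE natE)) natE
    (fun p => (p.1.getD p.2.1 []).getD p.2.2 0) :=
  (rawGetD natE natE_zero).comp (((rawGetD (rawE natE) rfl).comp ((fst _ _).pair (snd _ _).fst')).pair
    (snd _ _).snd')

/-- **Every expression is evaluated on codes in polynomial time.** [cite: AroraBarak2009, §1.3] -/
theorem codeFP_eval : ∀ e : NE, CodeFP envE natE (eval e)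
  | cst c => (const envE c).congr fun _ => rfl
  | var i => ((rawGetD natE natE_zero).comp (codeFP_nums.pair (const envE i))).congr fun _ => rfl
  | add a b => (natAdd.comp ((codeFP_eval a).pair (codeFP_eval b))).congr fun _ => rfl
  | sub a b => (natSub.comp ((codeFP_eval a).pair (codeFP_eval b))).congr fun _ => rfl
  | mul a b => (natMul.comp ((codeFP_eval a).pair (codeFP_eval b))).congr fun _ => rfl
  | div a b => (natDiv.comp ((codeFP_eval a).pair (codeFP_eval b))).congr fun _ => rfl
  | mod a b => (natMod.comp ((codeFP_eval a).pair (codeFP_eval b))).congr fun _ => rfl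
  | pow2 a => ((natPow.comp ((const envE 2).pair (unOfNatMin.comp (codeFP_cap.pair (codeFP_eval a))))).congr
      fun _ => rfl)
  | lt a b => (codeFP_lt01.comp ((codeFP_eval a).pair (codeFP_eval b))).congr fun _ => rfl
  | eq a b => (codeFP_eq01.comp ((codeFP_eval a).pair (codeFP_eval b))).congr fun _ => rfl
  | cond c t e => (((natEq.comp ((codeFP_eval c).pair (const envE 0))).ite (codeFP_eval e) (codeFP_eval t)).congr
      fun x => by simp only [eval, decide_eq_true_eq])
  | tab1 q c => (codeFP_get2.comp (codeFP_tab1.pair ((codeFP_eval q).pair (codeFP_eval c)))).congr fun _ => rfl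
  | tab2 n z => (codeFP_get2.comp (codeFP_tab2.pair ((codeFP_eval n).pair (codeFP_eval z)))).congr fun _ => rfl

/-- Appending the value of an expression to the numbers. [folklore] -/
def snoc (e : NE) (x : Env) : Env := (x.1, x.2.1 ++ [eval e x], x.2.2)

/-- `snoc` is computed on codes. [folklore] -/
theorem codeFP_snoc (e : NE) : CodeFP envE envE (snoc e) :=
  (codeFP_cap.pair ((((rawAppend natE).comp (codeFP_nums.pair ((rawSingleton natE).comp (codeFP_eval e)))).pair
    (codeFP_tab1.pair codeFP_tab2)))).congr fun _ => rfl

/-- Appending the values of a list of expressions, in order (each may read the previous ones).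
[folklore] -/
def snocs : List NE → Env → Env
  | [], x => x
  | e :: es, x => snocs es (snoc e x)

/-- `snocs` is computed on codes. [folklore] -/
theorem codeFP_snocs : ∀ es : List NE, CodeFP envE envE (snocs es)
  | [] => (CodeFP.id envE).congr fun _ => rfl
  | e :: es => ((codeFP_snocs es).comp (codeFP_snoc e)).congr fun _ => rfl

/-- The numbers after `snocs`: the old ones followed by the new values. [folklore] -/
theorem snocs_nums_prefix (es : List NE) (x : Env) : ∃ tl, (snocs es x).2.1 = x.2.1 ++ tl ∧ tl.length = es.length := by
  induction es generalizing x with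
  | nil => exact ⟨[], by simp [snocs]⟩
  | cons e es ih =>
    obtain ⟨tl, h1, h2⟩ := ih (snoc e x)
    refine ⟨eval e x :: tl, ?_, by simp [h2]⟩
    rw [snocs, h1]; simp [snoc]

/-- `snocs` keeps the cap and the tables. [folklore] -/
theorem snocs_cap_tabs (es : List NE) (x : Env) : (snocs es x).1 = x.1 ∧ (snocs es x).2.2 = x.2.2 := by
  induction es generalizing x with
  | nil => exact ⟨rfl, rfl⟩
  | cons e es ih => exact ih (snoc e x)

/-! ### Derived forms -/

/-- `[a ≤ b]`. [folklore] -/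
def le (a b : NE) : NE := lt a (add b (cst 1))
/-- Conjunction of `0/1` values. [folklore] -/
def and' (a b : NE) : NE := mul a b
/-- Negation of a `0/1` value. [folklore] -/
def not' (a : NE) : NE := cond a (cst 0) (cst 1)
/-- Disjunction. [folklore] -/
def or' (a b : NE) : NE := cond a (cst 1) b
/-- Bit `j` of `v`: `v / 2ʲ % 2`. [folklore] -/
def bit (j v : NE) : NE := mod (div v (pow2 j)) (cst 2)

/-- Value of `le`. [folklore] -/
@[simp] theorem eval_le (a b : NE) (x : Env) : eval (le a b) x = if eval a x ≤ eval b x then 1 else 0 := by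
  simp only [le, eval]; split_ifs <;> omega

/-- Value of `bit` below the cap. [folklore] -/
@[simp] theorem eval_bit (j v : NE) (x : Env) (hj : eval j x ≤ x.1) :
    eval (bit j v) x = eval v x / 2 ^ eval j x % 2 := by
  simp [bit, eval, min_eq_left hj]

end NE

end SkelExpr

end Literature.Computability.Complexity
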